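import Mathlib
import HarnessLib
import Literature.MathematicalPhysics.StatisticalMechanics.WeightTowerFactorisation

/-!
# The next-scale weight form is monotone in the covariance; the integration property against a
# dominated covariance (Adams–Buchholz–Kotecký–Müller, Lemma 7.2 (ii),(iv), Lemma 7.7 (ii) (7.83))

[ABKM19] defines the mid-scale weight with the INFLATED covariance `(1+θ̄)𝒞_{k+1}` ((7.5)) but
integrates, in Theorem 7.1 (w7), against the Gaussian measures `μ_{k+1}^{(q)}` of covariance
`𝒞^{(q)}_{k+1} ⪯ (1+θ̄)𝒞_{k+1}^{(0)}`; the last step of (7.83) is "the monotonicity of the inversion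
… combined with the bound `(1+ερ)𝒞^{(q)} ≤ (1+θ̄)𝒞^{(0)}`", i.e. the monotonicity of
`C ↦ (A⁻¹ − C)⁻¹`.  For the tree's invertibility-free `nextForm A C` this file proves

* `nextForm_eq_sqrt_mul_inv_mul_sqrt` — Lemma 7.2 (iv) (7.22): `nextForm A C = √A (1 − √A C √A)⁻¹ √A`
  for `A, C ⪰ 0` with `1 − √C A √C ≻ 0`;
* `nextForm_le_iff_cov` — the variational form `f ⪯ X ↔ ∀ v z, 2(√Av)·z − |z|² + (√Az)·C(√Az) ≤ vᵀXv`;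
* **`nextForm_mono_cov`** — `C₁ ⪯ C₂ ⇒ nextForm A C₁ ⪯ nextForm A C₂` (Lemma 7.2 (ii) in `C`);
* **`WeightData.integral_weight_add_le_of_cov_le`** — Theorem 7.1 (w7), shape, for ANY integration
  covariance `C' ⪯ cov k` with a margin `√C' D_k √C' ⪯ θ·1`, `θ < 1`:
  `∫ w_k^X(φ+ψ) N(0,C')(dψ) ≤ (1−θ)^{−tr(√C' A_k^X √C')/(2θ)} w_{k:k+1}^X(φ)`.

Everything is proved; no named fact.

## References
* S. Adams, S. Buchholz, R. Kotecký, S. Müller, arXiv:1910.13564, Lemma 7.2 (ii),(iv), Lemma 7.7 (ii)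
  (7.83) [AdamsBuchholzKoteckyMuller2019].
-/

noncomputable section

open Matrix MeasureTheory ProbabilityTheory WithLp
open scoped Matrix MatrixOrder

namespace Literature.MathematicalPhysics.StatisticalMechanics.GradientRG

open Literature.MathematicalPhysics.QuantumFieldTheory
open Literature.Analysis.Matrix (posSemidef_cfcSqrt conjTranspose_cfcSqrt posDef_one_sub_sqrt_mul_sqrt_iff
  det_one_sub_mul_eq_det_one_sub_sqrt_mul_sqrt)

variable {ι : Type*} [Fintype ι] [DecidableEq ι]

/-! ## Lemma 7.2 (iv): the square-root form -/

/-- **[ABKM19] (7.22)**: for `A, C ⪰ 0` with `1 − √C A √C ≻ 0`,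
`nextForm A C = √A (1 − √A C √A)⁻¹ √A`. [cite: AdamsBuchholzKoteckyMuller2019, Lemma 7.2 (iv) (7.22)] -/
theorem nextForm_eq_sqrt_mul_inv_mul_sqrt {A C : Matrix ι ι ℝ} (hA : A.PosSemidef) (hC : C.PosSemidef)
    (hR : ((1 : Matrix ι ι ℝ) - CFC.sqrt C * A * CFC.sqrt C).PosDef) :
    nextForm A C = CFC.sqrt A * ((1 : Matrix ι ι ℝ) - CFC.sqrt A * C * CFC.sqrt A)⁻¹ * CFC.sqrt A := by
  set S := CFC.sqrt A with hS
  have hSS : S * S = A := CFC.sqrt_mul_sqrt_self A hA.nonneg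
  have hP : ((1 : Matrix ι ι ℝ) - S * C * S).PosDef := (posDef_one_sub_sqrt_mul_sqrt_iff hC hA).1 hR
  have hPu : IsUnit ((1 : Matrix ι ι ℝ) - S * C * S).det :=
    (Matrix.isUnit_iff_isUnit_det _).1 hP.isUnit
  have hQu : IsUnit ((1 : Matrix ι ι ℝ) - C * A).det := by
    rw [det_one_sub_mul_eq_det_one_sub_sqrt_mul_sqrt hC]
    exact (Matrix.isUnit_iff_isUnit_det _).1 hR.isUnit
  rw [nextForm_eq_mul_inv_of_posDef hC hR]
  set P : Matrix ι ι ℝ := 1 - S * C * S with hPdef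
  -- `(1 − SCS) S = S (1 − CA)`, hence `S (1 − CA)⁻¹ = (1 − SCS)⁻¹ S`
  have hcomm : P * S = S * ((1 : Matrix ι ι ℝ) - C * A) := by
    simp only [hPdef, Matrix.sub_mul, Matrix.one_mul, Matrix.mul_sub, Matrix.mul_one, Matrix.mul_assoc,
      hSS]
  have hkey : S * ((1 : Matrix ι ι ℝ) - C * A)⁻¹ = P⁻¹ * S := by
    have h1 : P⁻¹ * (P * S) * ((1 : Matrix ι ι ℝ) - C * A)⁻¹ = S * ((1 : Matrix ι ι ℝ) - C * A)⁻¹ := by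
      rw [← Matrix.mul_assoc, Matrix.nonsing_inv_mul _ hPu, Matrix.one_mul]
    rw [← h1, hcomm, Matrix.mul_assoc, Matrix.mul_assoc, Matrix.mul_nonsing_inv _ hQu, Matrix.mul_one]
  calc A * ((1 : Matrix ι ι ℝ) - C * A)⁻¹ = S * (S * ((1 : Matrix ι ι ℝ) - C * A)⁻¹) := by
        rw [← Matrix.mul_assoc, hSS]
    _ = S * (P⁻¹ * S) := by rw [hkey]
    _ = S * P⁻¹ * S := by rw [Matrix.mul_assoc]

/-! ## Monotonicity in the covariance -/

omit [DecidableEq ι] in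
/-- Completing the square for a positive definite form: `2 b·z − zᵀPz ≤ bᵀP⁻¹b`.
[cite: AdamsBuchholzKoteckyMuller2019, Lemma 7.2 (ii) (proof)] -/
theorem two_mul_dotProduct_sub_quadForm_le [DecidableEq ι] {P : Matrix ι ι ℝ} (hP : P.PosDef)
    (b z : ι → ℝ) : 2 * (b ⬝ᵥ z) - z ⬝ᵥ P *ᵥ z ≤ b ⬝ᵥ P⁻¹ *ᵥ b := by
  have hPs : P.IsSymm := isHermitian_iff_isSymm.1 hP.1
  have hPt : Pᵀ = P := hPs
  have hPu : IsUnit P.det := (Matrix.isUnit_iff_isUnit_det _).1 hP.isUnit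
  set u := P⁻¹ *ᵥ b with hu
  have hPu' : P *ᵥ u = b := by rw [hu, Matrix.mulVec_mulVec, Matrix.mul_nonsing_inv P hPu, one_mulVec]
  -- `0 ≤ (z − u)ᵀ P (z − u) = zᵀPz − 2 bᵀz + bᵀP⁻¹b`
  have h0 := hP.posSemidef.dotProduct_mulVec_nonneg (z - u)
  rw [star_trivial, Matrix.mulVec_sub, sub_dotProduct, dotProduct_sub, dotProduct_sub, hPu'] at h0
  have h1 : u ⬝ᵥ P *ᵥ z = b ⬝ᵥ z := by
    rw [Matrix.dotProduct_mulVec u P z, ← Matrix.mulVec_transpose, hPt, hPu']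
  have h2 : u ⬝ᵥ b = b ⬝ᵥ P⁻¹ *ᵥ b := by rw [hu, dotProduct_comm]
  have h3 : z ⬝ᵥ b = b ⬝ᵥ z := dotProduct_comm z b
  rw [h1, h2, h3] at h0
  linarith

/-- **Variational form in the covariance**: for `A, C ⪰ 0`, `1 − √CA√C ≻ 0` and symmetric `X`:
`X − nextForm A C ⪰ 0 ↔ ∀ v z, 2(√Av)·z − (|z|² − (√Az)·C(√Az)) ≤ vᵀXv`.
[cite: AdamsBuchholzKoteckyMuller2019, Lemma 7.2 (ii),(iv)] -/
theorem nextForm_le_iff_cov {A C X : Matrix ι ι ℝ} (hA : A.PosSemidef) (hC : C.PosSemidef)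
    (hX : X.IsSymm) (hR : ((1 : Matrix ι ι ℝ) - CFC.sqrt C * A * CFC.sqrt C).PosDef) :
    (X - nextForm A C).PosSemidef ↔
      ∀ v z : ι → ℝ, 2 * ((CFC.sqrt A *ᵥ v) ⬝ᵥ z) -
        z ⬝ᵥ ((1 : Matrix ι ι ℝ) - CFC.sqrt A * C * CFC.sqrt A) *ᵥ z ≤ v ⬝ᵥ X *ᵥ v := by
  set S := CFC.sqrt A with hS
  set P : Matrix ι ι ℝ := 1 - S * C * S with hPdef
  have hP : P.PosDef := (posDef_one_sub_sqrt_mul_sqrt_iff hC hA).1 hR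
  have hAs : A.IsSymm := isHermitian_iff_isSymm.1 hA.1
  have hSt : Sᵀ = S := GaussianToolkit.transpose_sqrt (S := A)
  have hrep : nextForm A C = S * P⁻¹ * S := nextForm_eq_sqrt_mul_inv_mul_sqrt hA hC hR
  -- the quadratic form of `nextForm`: `vᵀ f v = (Sv)ᵀ P⁻¹ (Sv)`
  have hq : ∀ v, v ⬝ᵥ nextForm A C *ᵥ v = (S *ᵥ v) ⬝ᵥ P⁻¹ *ᵥ (S *ᵥ v) := by
    intro v
    rw [hrep, ← Matrix.mulVec_mulVec, ← Matrix.mulVec_mulVec, Matrix.dotProduct_mulVec v S,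
      ← Matrix.mulVec_transpose, hSt]
  have hsymm : (X - nextForm A C).IsHermitian := by
    rw [isHermitian_iff_isSymm]; exact hX.sub (isSymm_nextForm hAs C)
  constructor
  · intro h v z
    have h1 := h.dotProduct_mulVec_nonneg v
    rw [star_trivial, Matrix.sub_mulVec, dotProduct_sub, hq] at h1
    have h2 := two_mul_dotProduct_sub_quadForm_le hP (S *ᵥ v) z
    linarith
  · intro h
    refine Matrix.PosSemidef.of_dotProduct_mulVec_nonneg hsymm fun v => ?_
    rw [star_trivial, Matrix.sub_mulVec, dotProduct_sub, hq]
    -- take the optimiser `z = P⁻¹ S v`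
    have hPu : IsUnit P.det := (Matrix.isUnit_iff_isUnit_det _).1 hP.isUnit
    have hPt : Pᵀ = P := (isHermitian_iff_isSymm.1 hP.1 :)
    set b := S *ᵥ v with hb
    clear_value b
    have h1 := h v (P⁻¹ *ᵥ b)
    have h3 : P *ᵥ (P⁻¹ *ᵥ b) = b := by
      rw [Matrix.mulVec_mulVec, Matrix.mul_nonsing_inv P hPu, one_mulVec]
    have h2 : (P⁻¹ *ᵥ b) ⬝ᵥ P *ᵥ (P⁻¹ *ᵥ b) = b ⬝ᵥ P⁻¹ *ᵥ b := by
      rw [h3, dotProduct_comm]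
    rw [h2, ← hb] at h1
    linarith

/-- Subcriticality passes to a smaller covariance: `C₁ ⪯ C₂`, `1 − √C₂A√C₂ ≻ 0 ⇒ 1 − √C₁A√C₁ ≻ 0`
(for `A ⪰ 0`). [cite: AdamsBuchholzKoteckyMuller2019, Lemma 7.2 (iii)] -/
theorem posDef_one_sub_sqrt_mul_sqrt_anti_cov {A C₁ C₂ : Matrix ι ι ℝ} (hA : A.PosSemidef)
    (hC₁ : C₁.PosSemidef) (h12 : (C₂ - C₁).PosSemidef)
    (hR₂ : ((1 : Matrix ι ι ℝ) - CFC.sqrt C₂ * A * CFC.sqrt C₂).PosDef) :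
    ((1 : Matrix ι ι ℝ) - CFC.sqrt C₁ * A * CFC.sqrt C₁).PosDef :=
  Literature.Analysis.Matrix.posDef_one_sub_sqrt_mul_sqrt_mono hC₁ h12 hA hR₂

/-- **[ABKM19] Lemma 7.2 (ii) in the covariance**: for `A ⪰ 0`, `0 ⪯ C₁ ⪯ C₂` with
`1 − √C₂ A √C₂ ≻ 0`: `nextForm A C₁ ⪯ nextForm A C₂` ("monotonicity of the inversion", (7.83)).
[cite: AdamsBuchholzKoteckyMuller2019, Lemma 7.2 (ii)] -/
theorem nextForm_mono_cov {A C₁ C₂ : Matrix ι ι ℝ} (hA : A.PosSemidef) (hC₁ : C₁.PosSemidef)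
    (h12 : (C₂ - C₁).PosSemidef)
    (hR₂ : ((1 : Matrix ι ι ℝ) - CFC.sqrt C₂ * A * CFC.sqrt C₂).PosDef) :
    (nextForm A C₂ - nextForm A C₁).PosSemidef := by
  have hC₂ : C₂.PosSemidef := by have := hC₁.add h12; rwa [add_sub_cancel] at this
  have hR₁ := posDef_one_sub_sqrt_mul_sqrt_anti_cov hA hC₁ h12 hR₂
  have hAs : A.IsSymm := isHermitian_iff_isSymm.1 hA.1
  rw [nextForm_le_iff_cov hA hC₁ (isSymm_nextForm hAs C₂) hR₁]
  intro v z
  have hopt := (nextForm_le_iff_cov hA hC₂ (isSymm_nextForm hAs C₂) hR₂).1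
    (by rw [sub_self]; exact Matrix.PosSemidef.zero) v z
  -- the `C`-dependent term is monotone: `(Sz)·C₁(Sz) ≤ (Sz)·C₂(Sz)`
  have hmono := h12.dotProduct_mulVec_nonneg (CFC.sqrt A *ᵥ z)
  rw [star_trivial, Matrix.sub_mulVec, dotProduct_sub] at hmono
  have hexp : ∀ C : Matrix ι ι ℝ, z ⬝ᵥ ((1 : Matrix ι ι ℝ) - CFC.sqrt A * C * CFC.sqrt A) *ᵥ z =
      z ⬝ᵥ z - (CFC.sqrt A *ᵥ z) ⬝ᵥ C *ᵥ (CFC.sqrt A *ᵥ z) := by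
    intro C
    have hSt : (CFC.sqrt A)ᵀ = CFC.sqrt A := GaussianToolkit.transpose_sqrt (S := A)
    rw [Matrix.sub_mulVec, Matrix.one_mulVec, dotProduct_sub, ← Matrix.mulVec_mulVec,
      ← Matrix.mulVec_mulVec, Matrix.dotProduct_mulVec z (CFC.sqrt A), ← Matrix.mulVec_transpose, hSt]
  rw [hexp] at hopt ⊢
  linarith

/-! ## Theorem 7.1 (w7) against a dominated covariance -/

namespace WeightData

variable {Λ : Type*} [Fintype Λ] [DecidableEq Λ] {W : WeightData Λ}

/-- **Theorem 7.1 (w7), shape, for an integration covariance dominated by the step covariance**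
([ABKM19] (7.83): `μ_{k+1}^{(q)}` has covariance `𝒞^{(q)}_{k+1} ⪯ (1+θ̄)𝒞_{k+1} = cov k`): if
`0 ⪯ C' ⪯ cov k`, `cov k ⪰ 0` and `√C' D_k √C' ⪯ θ·1` with `0 < θ < 1`, then
`∫ w_k^X(φ+ψ) N(0,C')(dψ) ≤ (1−θ)^{−tr(√C' A_k^X √C')/(2θ)} · w_{k:k+1}^X(φ)`.
[cite: AdamsBuchholzKoteckyMuller2019, Lemma 7.7 (ii) (7.83)] -/
theorem integral_weight_add_le_of_cov_le {D : ℕ → Matrix Λ Λ ℝ} (hD : W.Dominated D) {k : ℕ}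
    {C' : Matrix Λ Λ ℝ} (hC' : C'.PosSemidef) (hC'le : (W.cov k - C').PosSemidef) {θ : ℝ}
    (hθ0 : 0 < θ) (hθ1 : θ < 1)
    (hmargin : (θ • (1 : Matrix Λ Λ ℝ) - CFC.sqrt C' * D k * CFC.sqrt C').PosSemidef)
    (X : Finset Λ) (φ : Λ → ℝ) :
    ∫ ψ, W.weight k X (φ + ofLp ψ) ∂(multivariateGaussian 0 C') ≤
      (1 - θ) ^ (-((CFC.sqrt C' * W.form k X * CFC.sqrt C').trace / (2 * θ))) *
        W.midWeight k X φ := by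
  have hA := form_posSemidef hD k X
  have hAs := form_isSymm hD k X
  have hmarginA := posSemidef_smul_one_sub_sqrt_mul_sqrt_anti (form_le hD k X) hmargin
  -- the Gaussian step against `C'`
  have hstep := integral_exp_half_quadForm_shift_le C' hAs hθ0 hθ1
    (posSemidef_sqrt_mul_sqrt hA _) hmarginA φ
  simp only [weight]
  refine hstep.trans (mul_le_mul_of_nonneg_left ?_ (Real.rpow_nonneg (by linarith) _))
  -- `nextForm A C' ⪯ nextForm A (cov k) = midForm`
  have hsub : ((1 : Matrix Λ Λ ℝ) - CFC.sqrt (W.cov k) * W.form k X * CFC.sqrt (W.cov k)).PosDef :=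
    form_subcritical hD k X
  exact exp_half_quadForm_le_of_posSemidef_sub (nextForm_mono_cov hA hC' hC'le hsub) φ

end WeightData

end Literature.MathematicalPhysics.StatisticalMechanics.GradientRG

end
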